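import Summits.ResolutionOfSingularities.ResolutionOfSingularities.Theorems.EquisingularLiftEquisingularLiftNatRouteCurrency
import Summits.ResolutionOfSingularities.ResolutionOfSingularities.Theorems.EquisingularLiftCampaignW45bULTWeakOfNat
import Literature.AlgebraicGeometry.GroupSchemes.GeneralLinearGroupActionProjectiveSpace
import Literature.AlgebraicGeometry.Resolution.BlowupDisjointCentreSplitting
import Literature.AlgebraicGeometry.Resolution.BlowupsLocal
import HarnessLib

/-!
# EL♮ in route currency is invariant under linear changes of coordinates of `ℙⁿ_k`
# (`ELNatAt p k n H (ι ≫ α_ḡ) → ELNatAt p k n H ι`, `ḡ ∈ GL_{n+1}(k)`) — the PGL transport (q1) of the leafhand-6 census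

[OURS · leafhand-res-equisingularlift-6 g3, 2026-08-31; cell `pub/decomp-res`; items stmt-ResolutionOfSingularities-20148 / -20038 (route currency
`Theorems.EquisingularLift.ELNatAt`)] AI-produced, weaker than expert review; NOT a statement of any manuscript; nothing here proves resolution of
singularities.  DEF-FREE; no `sorry`; standard axioms; ZERO named hypotheses; `--supports … --as helper`, counted 0.

The residual of the two route decls `EquisingularLiftNat` / `EquisingularLiftNatThree` in the stubs' currency
(✓ `RouteCurrency.equisingularLiftNat_of_forall_elnatO_primeForms`) asks for EL♮ at the NON-REGULAR integral hypersurfaces `range ι = V₊(F)`, `F` prime.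
All specimen theorems of the tree (✓ `LinCone.elNatAt_linCone`, ✓ `ConeN.elNatAt_cone`, ✓ `HypersurfaceSpecimen.elNatAt_smoothHypersurface`, …)
conclude for hypersurfaces IN FIXED COORDINATES `(hypersurface F, hypersurfaceι F)`.  To consume a normal form «`F` becomes `G` after an
invertible linear substitution» (e.g. ✓ `StrataSplit.quadric_normalForm`, …BlowupModelQuadrics) one needs the two transports of this file:

* `elNatAt_of_range_eq` — `ELNatAt p k n H ι` depends on `(H, ι)` only through `range ι` (the body reads `ι` only in
  `Y = range (ι ≫ Proj.map φ)`);
* ★ `elNatAt_of_elNatAt_comp_projLinAut` — **`ELNatAt p k n H (ι ≫ α_ḡ) → ELNatAt p k n H ι`** for the automorphism `α_ḡ` of `ℙⁿ_k` described by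
  `ḡ ∈ GL_{n+1}(k)` (✓ `ProjLinAction.projectiveSpaceLinAut`, Literature/…/GeneralLinearGroupActionProjectiveSpace).  Proof: keep the lift ring
  `(O, π)` of the hypothesis; lift `ḡ` to `g ∈ GL_{n+1}(O)` (`exists_generalLinearGroup_map_eq`: `O` local, `π` onto a field, `det` a unit);
  `α_g` is an automorphism of `ℙⁿ_O` OVER `Spec O` (✓ `projLinAut_inv_toSpecZero`) which intertwines `α_ḡ` through the special-fibre inclusion
  `Proj.map φ` (✓ `projLinAut_naturality`, after identifying `φ` with the graded base change `mapGraded O k` of the algebra `π`); hence the image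
  `Y₁` of `H` under `ι ≫ α_ḡ ≫ Proj.map φ` is `α_g(Y) = α_g⁻¹ ⁻¹' Y`, closed (✓ `isClosedImmersion_projMap`); a tower `(P', σ, S')` in the E1-chain
  closure of `(ℙⁿ_O, 𝟙, Y₁)` yields `(P', σ ≫ α_g⁻¹, S')` in the E1-chain closure of `(ℙⁿ_O, 𝟙, Y)` — `chain_transport`: ONE trivial step (the
  blow-up `α_g⁻¹ : ℙⁿ_O → ℙⁿ_O` along `⊤`, ✓ `isBlowup_id_top` + ✓ `IsBlowup.iso_comp`, centre `V(⊤) = ∅` regular ✓ `isRegular_subscheme_top`)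
  and then the given chain read through `Q' X σ' Y' := Q X (σ' ≫ α_g⁻¹) Y'` (generic points of `Y₁` ↔ of `Y` under the homeomorphism,
  `isGenericPoint_preimage_of_iso`; the special-fibre condition is unchanged because `α_g⁻¹` lies over `Spec O`); the special fibre of `P'` and the
  last strict transform `S'` are untouched, so irreducibility and regularity carry over verbatim.

Honest reading: plumbing (a symmetry of the route currency), no stub of 20148/20038/15660 closed.  Consumed by …NatELNatAtQuadrics (EL♮ for all
integral quadrics, every characteristic).

References: [Hartshorne1977, II Example 7.1.1 (automorphisms of `ℙⁿ`)]; [GortzWedhorn2020, (11.15), (13.2)] — through the cited tree file.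
-/

set_option linter.dupNamespace false -- mandated namespace `Summit.<Summit>.<Problem>` of this single-conjunct summit

noncomputable section

open CategoryTheory CategoryTheory.Limits AlgebraicGeometry TopologicalSpace Topology
open MvPolynomial HomogeneousIdeal
open Literature.AlgebraicGeometry.Resolution Literature.AlgebraicGeometry.Motives
open Literature.AlgebraicGeometry.GroupSchemes.ProjLinAction
open Summit.ResolutionOfSingularities.ResolutionOfSingularities.Theorems.EquisingularLift

namespace Summit.ResolutionOfSingularities.ResolutionOfSingularities.Cruxes.EquisingularLiftNat.Sections

namespace LinAutTransport

/-! ## Generic points under isomorphisms -/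

/-- If `e x` is a generic point of `S` then `x` is a generic point of `e ⁻¹' S` (`e` an isomorphism of schemes: closures commute with
homeomorphisms). [folklore] -/
theorem isGenericPoint_preimage_of_iso {X Y : Scheme.{0}} (e : X ≅ Y) {x : X} {S : Set Y}
    (h : IsGenericPoint (e.hom x) S) : IsGenericPoint x (e.hom ⁻¹' S) := by
  let f : X ≃ₜ Y := Scheme.homeoOfIso e
  have hf : ∀ y, f y = e.hom y := fun y => Scheme.homeoOfIso_apply e y
  rw [isGenericPoint_def] at h ⊢
  have h1 : closure ({e.hom x} : Set Y) = f '' closure {x} := by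
    rw [← hf, ← Set.image_singleton, ← f.image_closure]
  rw [h1] at h
  have h2 : e.hom ⁻¹' S = f ⁻¹' S := by
    ext y; simp [hf]
  rw [h2, ← h, f.preimage_image]

/-! ## The tower transport along an automorphism over the base -/

/-- **Tower transport.**  Let `B` be an automorphism of `P` over `s : P ⟶ T` (`B.inv ≫ s = s`), `Y ⊆ P`, `Y₁ = B.inv ⁻¹' Y` closed.  If
`(P', σ, S')` lies in the E1-chain closure of `(P, 𝟙, Y₁)`, then `(P', σ ≫ B.inv, S')` lies in the E1-chain closure of `(P, 𝟙, Y)`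
(one trivial step — the blow-up `B.inv` of `P` along `⊤` — followed by the given chain read through `σ' ↦ σ' ≫ B.inv`). [OURS · pure logic over
✓ `isBlowup_id_top`, ✓ `IsBlowup.iso_comp`, ✓ `isRegular_subscheme_top`] -/
theorem chain_transport {P T : Scheme.{0}} [IsLocallyNoetherian P] (s : P ⟶ T) (pt : T) (B : P ≅ P) (hB : B.inv ≫ s = s)
    (Y Y₁ : Set P) (hY₁ : Y₁ = B.inv ⁻¹' Y) (hY₁c : IsClosed Y₁)
    {P' : Scheme.{0}} (σ : P' ⟶ P) (S' : Set P')
    (htower : ∀ Q : (∀ X' : Scheme.{0}, (X' ⟶ P) → Set X' → Prop), Q P (𝟙 _) Y₁ →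
      (∀ (X' X'' : Scheme.{0}) (σ' : X' ⟶ P) (Y' : Set X') (C : X'.IdealSheafData) (τ : X'' ⟶ X'),
        Q X' σ' Y' → IsBlowup τ C → Scheme.IsRegular C.subscheme →
        σ' '' (C.support : Set X') ⊆ {x | ¬ IsGenericPoint x Y₁} →
        (C.support : Set X') ∩ (σ' ≫ s) ⁻¹' {pt} ⊆ Y' →
        Q X'' (τ ≫ σ') (closure (τ ⁻¹' (Y' \ (C.support : Set X'))))) → Q P' σ S') :
    ∀ Q : (∀ X' : Scheme.{0}, (X' ⟶ P) → Set X' → Prop), Q P (𝟙 _) Y →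
      (∀ (X' X'' : Scheme.{0}) (σ' : X' ⟶ P) (Y' : Set X') (C : X'.IdealSheafData) (τ : X'' ⟶ X'),
        Q X' σ' Y' → IsBlowup τ C → Scheme.IsRegular C.subscheme →
        σ' '' (C.support : Set X') ⊆ {x | ¬ IsGenericPoint x Y} →
        (C.support : Set X') ∩ (σ' ≫ s) ⁻¹' {pt} ⊆ Y' →
        Q X'' (τ ≫ σ') (closure (τ ⁻¹' (Y' \ (C.support : Set X'))))) → Q P' (σ ≫ B.inv) S' := by
  intro Q hQ0 hQstep
  let Q' : ∀ X' : Scheme.{0}, (X' ⟶ P) → Set X' → Prop := fun X' σ' Y' => Q X' (σ' ≫ B.inv) Y'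
  -- the trivial step: `B.inv` is the blow-up of `P` along `⊤`
  have h0 : Q' P (𝟙 _) Y₁ := by
    have hbl : IsBlowup B.inv (⊤ : P.IdealSheafData) := by
      have h := (isBlowup_id_top P).iso_comp B.symm
      rwa [Iso.symm_hom, Category.comp_id] at h
    have h := hQstep P P (𝟙 _) Y ⊤ B.inv hQ0 hbl isRegular_subscheme_top
      (by rw [Scheme.IdealSheafData.support_top]; simp) (by rw [Scheme.IdealSheafData.support_top]; simp)
    rw [Scheme.IdealSheafData.support_top] at h
    have hset : closure (B.inv ⁻¹' (Y \ ((⊥ : Closeds P) : Set P))) = Y₁ := by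
      rw [Closeds.coe_bot, Set.sdiff_empty, ← hY₁, hY₁c.closure_eq]
    rw [hset, Category.comp_id] at h
    show Q P (𝟙 _ ≫ B.inv) Y₁
    rwa [Category.id_comp]
  have hstep : ∀ (X' X'' : Scheme.{0}) (σ' : X' ⟶ P) (Y' : Set X') (C : X'.IdealSheafData) (τ : X'' ⟶ X'),
      Q' X' σ' Y' → IsBlowup τ C → Scheme.IsRegular C.subscheme →
      σ' '' (C.support : Set X') ⊆ {x | ¬ IsGenericPoint x Y₁} →
      (C.support : Set X') ∩ (σ' ≫ s) ⁻¹' {pt} ⊆ Y' →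
      Q' X'' (τ ≫ σ') (closure (τ ⁻¹' (Y' \ (C.support : Set X')))) := by
    intro X' X'' σ' Y' C τ hQ' hτ hC h1 h2
    show Q X'' ((τ ≫ σ') ≫ B.inv) _
    rw [Category.assoc]
    refine hQstep X' X'' (σ' ≫ B.inv) Y' C τ hQ' hτ hC ?_ ?_
    · rintro _ ⟨c, hc, rfl⟩ hgen
      refine h1 ⟨c, hc, rfl⟩ ?_
      rw [Scheme.Hom.comp_apply] at hgen
      have h := isGenericPoint_preimage_of_iso B.symm (x := σ' c) (S := Y) hgen
      rwa [Iso.symm_hom, ← hY₁] at h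
    · rw [Category.assoc, hB]
      exact h2
  exact htower Q' h0 hstep

/-! ## Lifting an invertible matrix along a surjection from a local ring onto a field -/

/-- **`GL_m(O) → GL_m(k)` is surjective** for a surjection `π : O → k` from a local ring onto a field: lift the entries; the determinant of
the lift maps to `det gk ≠ 0`, so it lies outside the maximal ideal `ker π` and is a unit. -/
theorem exists_generalLinearGroup_map_eq {O k : Type} [CommRing O] [IsLocalRing O] [Field k] (π : O →+* k)
    (hπ : Function.Surjective π) {m : Type} [Fintype m] [DecidableEq m] (gk : GL m k) :
    ∃ g : GL m O, Matrix.GeneralLinearGroup.map π g = gk := by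
  choose M hM using fun i j => hπ (gk i j)
  let A : Matrix m m O := Matrix.of M
  have hA : A.map π = (gk : Matrix m m k) := Matrix.ext fun i j => hM i j
  have hdet : IsUnit A.det := by
    by_contra hnu
    have hmem : A.det ∈ IsLocalRing.maximalIdeal O := hnu
    have hker : RingHom.ker π = IsLocalRing.maximalIdeal O :=
      IsLocalRing.eq_maximalIdeal (RingHom.ker_isMaximal_of_surjective π hπ)
    rw [← hker, RingHom.mem_ker, RingHom.map_det, RingHom.mapMatrix_apply, hA] at hmem
    have hu : IsUnit (gk : Matrix m m k).det := (Matrix.isUnit_iff_isUnit_det _).mp (Units.isUnit gk)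
    exact hu.ne_zero hmem
  have hAunit : IsUnit A := (Matrix.isUnit_iff_isUnit_det A).mpr hdet
  refine ⟨hAunit.unit, Units.ext ?_⟩
  refine Matrix.ext fun i j => ?_
  rw [Matrix.GeneralLinearGroup.map_apply]
  exact hM i j

/-! ## Images and preimages under an automorphism -/

/-- `B.inv ⁻¹' Y = B.hom '' Y` for an isomorphism of schemes `B`. [folklore] -/
theorem preimage_inv_eq_image_hom {P P₁ : Scheme.{0}} (B : P ≅ P₁) (Y : Set P) : B.inv ⁻¹' Y = B.hom '' Y := by
  ext x
  constructor
  · intro hx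
    refine ⟨B.inv x, hx, ?_⟩
    rw [← Scheme.Hom.comp_apply, B.inv_hom_id]
    rfl
  · rintro ⟨y, hy, rfl⟩
    show B.inv (B.hom y) ∈ Y
    rw [← Scheme.Hom.comp_apply, B.hom_inv_id]
    exact hy

/-- `range (f ≫ g) = g '' range f`. [folklore] -/
theorem range_comp_eq_image {X Y Z : Scheme.{0}} (f : X ⟶ Y) (g : Y ⟶ Z) :
    Set.range (f ≫ g) = g '' Set.range f := by
  ext z
  constructor
  · rintro ⟨x, rfl⟩
    exact ⟨f x, ⟨x, rfl⟩, (Scheme.Hom.comp_apply f g x).symm⟩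
  · rintro ⟨_, ⟨x, rfl⟩, rfl⟩
    exact ⟨x, Scheme.Hom.comp_apply f g x⟩

/-! ## `ELNatAt` only depends on the image of `H` in `ℙⁿ_k` -/

/-- **`ELNatAt p k n H ι` depends on `(H, ι)` only through `range ι`**: the body mentions `ι` only in `Y = range (ι ≫ Proj.map φ)`
`= (Proj.map φ) '' (range ι)`. [OURS · pure logic] -/
theorem elNatAt_of_range_eq (p : ℕ) (k : Type) [Field k] [CharP k p] [IsAlgClosed k] (n : ℕ) {H H' : Scheme.{0}}
    (ι : H ⟶ (projectiveSpace n k).left) (ι' : H' ⟶ (projectiveSpace n k).left) (hrange : Set.range ι = Set.range ι')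
    (h : ELNatAt p k n H' ι') : ELNatAt p k n H ι := by
  obtain ⟨O, _, _, _, _, π, hπ, htower⟩ := h
  refine ⟨O, inferInstance, inferInstance, inferInstance, inferInstance, π, hπ, ?_⟩
  intro φ hφ' hφ Y hY
  exact htower φ hφ' hφ Y (by rw [hY, range_comp_eq_image, range_comp_eq_image, hrange])

/-! ## ★ `ELNatAt` is invariant under linear automorphisms of `ℙⁿ_k` -/

/-- ★ **`ELNatAt` transports along a linear change of coordinates of `ℙⁿ_k`.**  If the per-`H` body of EL♮ holds for `H` embedded by
`ι ≫ α_gk` (`α_gk` the automorphism of `ℙⁿ_k` described by `gk ∈ GL_{n+1}(k)`), it holds for `H` embedded by `ι`.  Proof: keep the lift ring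
`(O, π)`; lift `gk` to `g ∈ GL_{n+1}(O)` (`O` is local, `π` surjective); `α_g` is an automorphism of `ℙⁿ_O` over `Spec O` intertwining `α_gk`
through the special-fibre inclusion `Proj.map φ` (naturality of the `GL`-action in the base), so `Y₁ = α_g(Y)`; a tower for `(ℙⁿ_O, 𝟙, Y₁)`
becomes one for `(ℙⁿ_O, 𝟙, Y)` by one trivial step (the blow-up `α_g⁻¹` along `⊤`) and re-reading every stage through `σ' ↦ σ' ≫ α_g⁻¹`
(`chain_transport`); the special fibre and the last strict transform are unchanged. [OURS · DEF-FREE]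
[cite: Hartshorne1977, II Example 7.1.1] -/
theorem elNatAt_of_elNatAt_comp_projLinAut (p : ℕ) (k : Type) [Field k] [CharP k p] [IsAlgClosed k] (n : ℕ)
    (H : Scheme.{0}) (ι : H ⟶ (projectiveSpace n k).left) [IsClosedImmersion ι] (gk : GL (Fin (n + 1)) k)
    (h : ELNatAt p k n H (ι ≫ (projectiveSpaceLinAut n k gk).hom.left)) : ELNatAt p k n H ι := by
  classical
  letI := MvPolynomial.gradedAlgebra (σ := Fin (n + 1)) (R := k)
  obtain ⟨O, _, _, _, _, π, hπ, htower⟩ := h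
  refine ⟨O, inferInstance, inferInstance, inferInstance, inferInstance, π, hπ, ?_⟩
  letI := MvPolynomial.gradedAlgebra (σ := Fin (n + 1)) (R := O)
  intro φ hφ' hφ Y hY
  -- lift `gk` to `g ∈ GL_{n+1}(O)`
  obtain ⟨g, hg⟩ := exists_generalLinearGroup_map_eq π hπ gk
  -- identify `φ` with the graded base-change map of the algebra `π : O → k`
  letI : Algebra O k := π.toAlgebra
  have hφeq : φ = ProjBaseChangeRing.mapGraded O k (Fin (n + 1)) :=
    GradedRingHom.ext fun t => by rw [hφ, ProjBaseChangeRing.mapGraded_apply]; rfl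
  have hmapeq : Proj.map φ hφ' =
      Proj.map (ProjBaseChangeRing.mapGraded O k (Fin (n + 1))) (ProjBaseChangeRing.irrelevant_le_map O k _) := by
    subst hφeq; rfl
  -- naturality: `α_gk ≫ Proj.map φ = Proj.map φ ≫ α_g`
  set B : Proj (homogeneousSubmodule (Fin (n + 1)) O) ≅ Proj (homogeneousSubmodule (Fin (n + 1)) O) := projLinAut g with hBdef
  have hnat : (projectiveSpaceLinAut n k gk).hom.left ≫ Proj.map φ hφ' = Proj.map φ hφ' ≫ B.hom := by
    have h1 := projLinAut_naturality O k (Fin (n + 1)) g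
    have hgk : Matrix.GeneralLinearGroup.map (algebraMap O k) g = gk := hg
    rw [hgk] at h1
    rw [hmapeq]
    exact h1
  have hcomp : (ι ≫ (projectiveSpaceLinAut n k gk).hom.left) ≫ Proj.map φ hφ' = (ι ≫ Proj.map φ hφ') ≫ B.hom := by
    rw [Category.assoc, Category.assoc, hnat]
    rfl
  -- the structure morphism and `B.inv` over it
  have hBs : B.inv ≫ (Proj.toSpecZero (homogeneousSubmodule (Fin (n + 1)) O) ≫
      Spec.map (CommRingCat.ofHom (algebraMap O (homogeneousSubmodule (Fin (n + 1)) O 0)))) =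
      Proj.toSpecZero (homogeneousSubmodule (Fin (n + 1)) O) ≫
        Spec.map (CommRingCat.ofHom (algebraMap O (homogeneousSubmodule (Fin (n + 1)) O 0))) := by
    rw [← Category.assoc, projLinAut_inv_toSpecZero]
  -- the two images
  set Y₁ : Set (Proj (homogeneousSubmodule (Fin (n + 1)) O)) :=
    Set.range ((ι ≫ (projectiveSpaceLinAut n k gk).hom.left) ≫ Proj.map φ hφ') with hY₁def
  have hY₁ : Y₁ = B.inv ⁻¹' Y := by
    rw [preimage_inv_eq_image_hom, hY, hY₁def, hcomp, range_comp_eq_image]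
  have hY₁c : IsClosed Y₁ := by
    rw [hY₁def]
    haveI := isClosedImmersion_projMap π hπ φ hφ hφ'
    haveI : IsIso (projectiveSpaceLinAut n k gk).hom.left := by
      change IsIso (projLinAut gk).hom
      infer_instance
    haveI : IsClosedImmersion (projectiveSpaceLinAut n k gk).hom.left := inferInstance
    haveI h1 : IsClosedImmersion (ι ≫ (projectiveSpaceLinAut n k gk).hom.left) := IsClosedImmersion.comp _ _
    haveI h2 : IsClosedImmersion ((ι ≫ (projectiveSpaceLinAut n k gk).hom.left) ≫ Proj.map φ hφ') :=
      @IsClosedImmersion.comp _ _ _ _ _ h1 (isClosedImmersion_projMap π hπ φ hφ hφ')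
    exact (Scheme.Hom.isClosedEmbedding (((ι ≫ (projectiveSpaceLinAut n k gk).hom.left) ≫ Proj.map φ hφ'))).isClosed_range
  obtain ⟨P', σ, S', hQ, hirr, hreg⟩ := htower φ hφ' hφ Y₁ hY₁def
  refine ⟨P', σ ≫ B.inv, S', ?_, ?_, hreg⟩
  · obtain ⟨hsm, -⟩ := Cruxes.EquisingularLift.StrataSplit.stub_projectiveAmbientSmoothProper O n
    haveI : IsLocallyNoetherian (Proj (homogeneousSubmodule (Fin (n + 1)) O)) := by
      haveI := hsm
      exact LocallyOfFiniteType.isLocallyNoetherian (Proj.toSpecZero (homogeneousSubmodule (Fin (n + 1)) O) ≫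
        Spec.map (CommRingCat.ofHom (algebraMap O (homogeneousSubmodule (Fin (n + 1)) O 0))))
    exact chain_transport _ (IsLocalRing.closedPoint O) B hBs Y Y₁ hY₁ hY₁c σ S' hQ
  · rwa [Category.assoc, hBs]

end LinAutTransport

end Summit.ResolutionOfSingularities.ResolutionOfSingularities.Cruxes.EquisingularLiftNat.Sections

end
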